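import Summits.BirchSwinnertonDyer.BirchSwinnertonDyer.Theses.PlecticLegs
import Summits.Langlands.Langlands.Theses.AdjointEulerNumerical
import Literature.NumberTheory.EllipticCurves.Selmer
import Literature.NumberTheory.EllipticCurves.GaloisAction
import Literature.NumberTheory.EllipticCurves.SelmerCorankHolds
import Literature.NumberTheory.EllipticCurves.AnalyticRank
import Literature.NumberTheory.EllipticCurves.SelmerFirstZeroTotallyReal
import Literature.NumberTheory.Automorphic.TotallyRealModularity
import HarnessLib

/-!
# Crux `PlecticLegs.PlecticPointsLB` (stmt-BirchSwinnertonDyer-17518), line `Sketch`, stub A `stub_firstZero` —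
# what the first-zero stub reduces to (worker A for lead a1, 2026-08-17)

The registered stub A of `Cruxes/PlecticPointsLB/Lines/Sketch.lean` (= stub A of `Lines/selmer_ladder.lean`) reads:
for `F` totally real, `V/F` elliptic and an ADMISSIBLE prime `p` (`5 ≤ p`, `p ∤ disc F`, `ρ̄_{V,p}` irreducible,
good ordinary above `p` — read on Mathlib's `localPolynomial`), `1 ≤ ord_{s=1} L(V/F,s) ⇒ 1 ≤ corank_{ℤ_p} Sel_{p^∞}(V/F)`.
It is NOT provable outright (Eisenstein congruences on `U(2,2)/F`). In print it is X. Wan, Forum Math. Sigma 3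
(2015) e18, THEOREM 7 (pp. 5–6), for MODULAR `V` (a Hilbert newform `f` of parallel weight `2` with `L(V,s) =
L(f,s)`), `p` odd unramified in `F`, `f` good ordinary above `p`, `ρ̄_f` irreducible, and (iii) "if `[F:ℚ]` is even
and the global sign of `f` is `−1`, then the automorphic representation of `f` is not a principal series in at
least one finite place"; in weight `2` his Conjecture 6 is Nekovář's theorem (Canad. J. Math. 2012, Thm. B), so
the theorem is unconditional there (his Thm. 102). That theorem, specialised to elliptic curves, is now the named
fact `Literature.NumberTheory.EllipticCurves.Wan2015_theorem7_ellipticCurve` (proposal p164649, ACCEPTED,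
commit 9dfbf5f3596d, file `Literature/NumberTheory/EllipticCurves/SelmerFirstZeroTotallyReal.lean`), imported here
(hypothesis `hW` throughout).

This file records, sorry-free, what A hinges on:

* `stub_firstZero_of_wan` — **A verbatim** from three closed hypotheses: `Wan2015_theorem7_ellipticCurve` (Wan's Thm. 7, the tree fact, `hW`),
  modularity of every elliptic curve over every totally real field in the tree's form (the Langlands crux
  `Summit.Langlands.Langlands.Theses.AdjointEulerNumerical.TotallyRealWeightZeroAutomorphic`, ledger
  stmt-Langlands-2176: OPEN for `[F:ℚ] ≥ 5` and for quartic `F ∋ √5`; FLS 2015 / DNS 2020 / Box 2022 below it), and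
  `hOdd` — the one case Wan's (iii) does not cover for free: `[F:ℚ]` even and `ord_{s=1} L(V/F,s)`
  odd (sign `−1`) ⇒ `1 ≤ corank`. That case is the `p`-PARITY theorem (Nekovář 2013 Thm. A ⇒ corank odd ⇒ `≥ 1`;
  it is the registered stub B `stub_parity` read at odd order, by `omega` — B is not restated here), or
  Nekovář–Zhang under (iii). So: A = Wan ∧ modularity ∧ (B at even degree, odd order).
* `stub_firstZero_plectic_of_wan` — **in the plectic regime (indeed whenever `ord_{s=1} L(V/F,s) ≡ [F:ℚ] (mod 2)`)
  NO parity input is needed**: Wan's (iii) is then vacuous. The line applies A only at `r_an = d`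
  (`plecticSelmerLB_of_ladder`, `hran`), so the lead may RESHAPE A to carry `V.analyticRank % 2 =
  Module.finrank ℚ F % 2` (or `V.analyticRank = Module.finrank ℚ F`) and drop B from inside A.
* `stub_firstZero_three_of_wan_of_DNS`, `stub_firstZero_two_of_wan_of_FLS`, `stub_firstZero_four_of_wan_of_Box` —
  the degrees where modularity is a PRINTED theorem (tree facts `DNS2020_theorem4`, `FLS2015_theorem1`,
  `Box2022_theorem1_1` of `TotallyRealModularity.lean`): in degree `3` the stub (restricted to cubic `F`) follows
  from the two printed theorems Wan Thm. 7 + DNS Thm. 4 and nothing else; in degrees `2` and `4 ∌ √5` from Wan +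
  FLS Thm. 1 / Box Thm. 1.1 at even order (in particular at `r_an = d`).
* The bridge `V ↦` integral model: the tree lemma `WeierstrassCurve.exists_variableChange_smul_baseChange_eq`
  (same file as the fact: every `V` over a number field is `F`-isomorphic to the base change of a model over
  `𝓞 F`) and `Δ_ne_zero_of_smul_baseChange_eq`, `exists_integralModel_isAutomorphicOfWeightZero` below.

No junk bridge (`analyticRank ≠ 0 → HasEntireLFunction`) is needed: the fact is stated on `1 ≤ V.analyticRank`
directly (for modular `V`, `L(V,s) = L(f,s)` is entire — Shimura 1978 — so `analyticRank` is the genuine order).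
-/

set_option linter.dupNamespace false -- single-conjunct summit: Sub = Summit (D-0017)

open scoped NumberField Polynomial
open NumberField IsDedekindDomain

noncomputable section

namespace Summit.BirchSwinnertonDyer.BirchSwinnertonDyer.Theorems

open Literature.NumberTheory.EllipticCurves Literature.NumberTheory.Automorphic
open Summit.Langlands.Langlands.Theses.AdjointEulerNumerical (TotallyRealWeightZeroAutomorphic)

/-! ## The residual parity case (documentation; taken INLINE as the hypothesis `hOdd` below) -/

/-
**The case Wan's hypothesis (iii) leaves out: even degree, sign `−1`** (the hypothesis `hOdd` of
`stub_firstZero_of_wan`, written out inline there so that this file declares no `def : Prop`). For `F` totally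
real of EVEN degree, `V/F` elliptic, `p` admissible as in the stub, and `ord_{s=1} L(V/F,s)` ODD:
`1 ≤ corank_{ℤ_p} Sel_{p^∞}(V/F)`. In print: the `p`-parity theorem over totally real fields (Nekovář 2013,
Thm. A: `corank ≡ ord (mod 2)`, so the corank is odd) — i.e. the registered stub B `stub_parity` of this line
read at odd order (`omega`); or, under (iii), Nekovář–Zhang (Wan, p. 6). B is not restated here.
-/

/-! ## The bridge from `V/F` to an integral model -/

/-- An integral model of an elliptic curve has non-zero discriminant: if `C • E.baseChange F = V` with `V`
elliptic then `E.Δ ≠ 0` (`Δ(C • W) = u^{-12} Δ(W)`, `Δ(E_F) = Δ(E)` in `F`). [folklore] -/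
theorem Δ_ne_zero_of_smul_baseChange_eq {F : Type} [Field F] [NumberField F] {V : WeierstrassCurve F}
    [V.IsElliptic] {E : WeierstrassCurve (𝓞 F)} {C : WeierstrassCurve.VariableChange F}
    (h : C • E.baseChange F = V) : E.Δ ≠ 0 := by
  intro hE
  apply V.isUnit_Δ.ne_zero
  rw [← h, WeierstrassCurve.variableChange_Δ, WeierstrassCurve.baseChange, WeierstrassCurve.map_Δ, hE,
    map_zero, mul_zero]

/-- **Modularity supply ⇒ the fact's modularity clause.** If every integral model with `Δ ≠ 0` over every totally
real field is automorphic of weight zero (the Langlands crux `TotallyRealWeightZeroAutomorphic`), then every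
elliptic `V` over a totally real `F` has an integral model `E`, `C • E.baseChange F = V`, with
`IsAutomorphicOfWeightZero E`. [folklore] -/
theorem exists_integralModel_isAutomorphicOfWeightZero (hMod : TotallyRealWeightZeroAutomorphic)
    (F : Type) [Field F] [NumberField F] [IsTotallyReal F] (V : WeierstrassCurve F) [V.IsElliptic] :
    ∃ (E : WeierstrassCurve (𝓞 F)) (C : WeierstrassCurve.VariableChange F),
      C • E.baseChange F = V ∧ IsAutomorphicOfWeightZero E := by
  obtain ⟨E, C, h⟩ := V.exists_variableChange_smul_baseChange_eq (R := 𝓞 F)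
  exact ⟨E, C, h, hMod F E (Δ_ne_zero_of_smul_baseChange_eq h)⟩

/-! ## Stub A from Wan's theorem -/

/-- **Core step.** Under the stub's binders, if `V` has a weight-zero automorphic integral model and
`ord_{s=1} L(V/F,s) ≡ [F:ℚ] (mod 2)` — so that Wan's hypothesis (iii) is vacuous: `[F:ℚ]` even forces the order
even — then `1 ≤ ord ⇒ 1 ≤ corank_{ℤ_p} Sel_{p^∞}(V/F)` by `Wan2015_theorem7_ellipticCurve`. [cite: Wan2015HilbertIMC, Thm. 7] -/
theorem one_le_selmerCorank_of_wan_of_model (hW : Wan2015_theorem7_ellipticCurve)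
    (F : Type) [Field F] [NumberField F] [IsTotallyReal F] (V : WeierstrassCurve F) [V.IsElliptic]
    (p : ℕ) [Fact p.Prime] (h5 : 5 ≤ p) (hdisc : ¬ ((p : ℤ) ∣ NumberField.discr F))
    (hirr : V.HasIrreducibleModPGaloisRep p)
    (hord : ∀ 𝔭 : HeightOneSpectrum (𝓞 F), (p : 𝓞 F) ∈ 𝔭.asIdeal →
      ((V.baseChange (𝔭.adicCompletion F)).localPolynomial (𝔭.adicCompletionIntegers F)).natDegree = 2 ∧
      ¬ (p : ℤ) ∣ ((V.baseChange (𝔭.adicCompletion F)).localPolynomial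
        (𝔭.adicCompletionIntegers F)).coeff 1)
    (hmod : ∃ (E : WeierstrassCurve (𝓞 F)) (C : WeierstrassCurve.VariableChange F),
      C • E.baseChange F = V ∧ IsAutomorphicOfWeightZero E)
    (hpar : V.analyticRank % 2 = Module.finrank ℚ F % 2) (hpos : 1 ≤ V.analyticRank) :
    1 ≤ V.selmerCorank p := by
  refine hW F V p h5 hdisc hirr hord hmod ?_ hpos
  intro hd hodd
  exfalso
  rw [Nat.even_iff] at hd
  rw [Nat.odd_iff] at hodd
  omega

/-- **A in the plectic regime needs no parity input.** Under the stub's binders plus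
`ord_{s=1} L(V/F,s) ≡ [F:ℚ] (mod 2)` (in particular in the plectic regime `r_an = [F:ℚ]`, the only place the
line uses A: `plecticSelmerLB_of_ladder`), A follows from Wan's Thm. 7 (`Wan2015_theorem7_ellipticCurve`) and modularity of
elliptic curves over totally real fields (`TotallyRealWeightZeroAutomorphic`, open for `[F:ℚ] ≥ 5`).
[cite: Wan2015HilbertIMC, Thm. 7] -/
theorem stub_firstZero_plectic_of_wan (hW : Wan2015_theorem7_ellipticCurve) (hMod : TotallyRealWeightZeroAutomorphic) :
    ∀ (F : Type) [Field F] [NumberField F] [NumberField.IsTotallyReal F] (V : WeierstrassCurve F)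
      [V.IsElliptic] (p : ℕ) [Fact p.Prime], 5 ≤ p → ¬ ((p : ℤ) ∣ NumberField.discr F) →
      V.HasIrreducibleModPGaloisRep p →
      (∀ 𝔭 : HeightOneSpectrum (𝓞 F), (p : 𝓞 F) ∈ 𝔭.asIdeal →
        ((V.baseChange (𝔭.adicCompletion F)).localPolynomial (𝔭.adicCompletionIntegers F)).natDegree = 2 ∧
        ¬ (p : ℤ) ∣ ((V.baseChange (𝔭.adicCompletion F)).localPolynomial
          (𝔭.adicCompletionIntegers F)).coeff 1) →
      V.analyticRank % 2 = Module.finrank ℚ F % 2 → 1 ≤ V.analyticRank → 1 ≤ V.selmerCorank p := by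
  intro F _ _ _ V _ p _ h5 hdisc hirr hord hpar hpos
  exact one_le_selmerCorank_of_wan_of_model hW F V p h5 hdisc hirr hord
    (exists_integralModel_isAutomorphicOfWeightZero hMod F V) hpar hpos

/-- **Stub A, VERBATIM, from Wan's Thm. 7 + modularity + the even-degree sign-`−1` case.** Given
`Wan2015_theorem7_ellipticCurve` (Wan 2015 Thm. 7 for elliptic curves, p164649), modularity of elliptic curves over totally real
fields (`TotallyRealWeightZeroAutomorphic`, ledger stmt-Langlands-2176 — open in degree `≥ 5`), and
`hOdd` (the even-degree, odd-order case: the `p`-parity theorem, Nekovář 2013 Thm. A — stub B of the line gives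
it by `omega`), the registered stub `stub_firstZero` holds. Case split on `[F:ℚ]` even ∧ order odd.
[cite: Wan2015HilbertIMC, Thm. 7] -/
theorem stub_firstZero_of_wan (hW : Wan2015_theorem7_ellipticCurve) (hMod : TotallyRealWeightZeroAutomorphic)
    (hOdd : ∀ (F : Type) [Field F] [NumberField F] [NumberField.IsTotallyReal F] (V : WeierstrassCurve F)
      [V.IsElliptic] (p : ℕ) [Fact p.Prime], 5 ≤ p → ¬ ((p : ℤ) ∣ NumberField.discr F) →
      V.HasIrreducibleModPGaloisRep p →
      (∀ 𝔭 : HeightOneSpectrum (𝓞 F), (p : 𝓞 F) ∈ 𝔭.asIdeal →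
        ((V.baseChange (𝔭.adicCompletion F)).localPolynomial (𝔭.adicCompletionIntegers F)).natDegree = 2 ∧
        ¬ (p : ℤ) ∣ ((V.baseChange (𝔭.adicCompletion F)).localPolynomial
          (𝔭.adicCompletionIntegers F)).coeff 1) →
      Even (Module.finrank ℚ F) → Odd V.analyticRank → 1 ≤ V.selmerCorank p) :
    ∀ (F : Type) [Field F] [NumberField F] [NumberField.IsTotallyReal F] (V : WeierstrassCurve F)
      [V.IsElliptic] (p : ℕ) [Fact p.Prime], 5 ≤ p → ¬ ((p : ℤ) ∣ NumberField.discr F) →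
      V.HasIrreducibleModPGaloisRep p →
      (∀ 𝔭 : HeightOneSpectrum (𝓞 F), (p : 𝓞 F) ∈ 𝔭.asIdeal →
        ((V.baseChange (𝔭.adicCompletion F)).localPolynomial (𝔭.adicCompletionIntegers F)).natDegree = 2 ∧
        ¬ (p : ℤ) ∣ ((V.baseChange (𝔭.adicCompletion F)).localPolynomial
          (𝔭.adicCompletionIntegers F)).coeff 1) →
      1 ≤ V.analyticRank → 1 ≤ V.selmerCorank p := by
  intro F _ _ _ V _ p _ h5 hdisc hirr hord hpos
  by_cases hcase : Even (Module.finrank ℚ F) ∧ Odd V.analyticRank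
  · exact hOdd F V p h5 hdisc hirr hord hcase.1 hcase.2
  · refine hW F V p h5 hdisc hirr hord (exists_integralModel_isAutomorphicOfWeightZero hMod F V) ?_ hpos
    intro hd hodd
    exact absurd ⟨hd, hodd⟩ hcase

/-! ## The degrees where modularity is in print -/

/-- **Degree 3: stub A for totally real CUBIC fields from two printed theorems** — Wan 2015 Thm. 7
(`Wan2015_theorem7_ellipticCurve`) and Derickx–Najman–Siksek 2020 Thm. 4 (`DNS2020_theorem4`: every elliptic curve over a totally
real cubic field is modular). Odd degree makes Wan's (iii) vacuous, so no parity input.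
[cite: Wan2015HilbertIMC, Thm. 7] [cite: DerickxNajmanSiksek2020, Thm. 4] -/
theorem stub_firstZero_three_of_wan_of_DNS (hW : Wan2015_theorem7_ellipticCurve) (hDNS : DNS2020_theorem4) :
    ∀ (F : Type) [Field F] [NumberField F] [NumberField.IsTotallyReal F] (V : WeierstrassCurve F)
      [V.IsElliptic] (p : ℕ) [Fact p.Prime], Module.finrank ℚ F = 3 → 5 ≤ p → ¬ ((p : ℤ) ∣ NumberField.discr F) →
      V.HasIrreducibleModPGaloisRep p →
      (∀ 𝔭 : HeightOneSpectrum (𝓞 F), (p : 𝓞 F) ∈ 𝔭.asIdeal →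
        ((V.baseChange (𝔭.adicCompletion F)).localPolynomial (𝔭.adicCompletionIntegers F)).natDegree = 2 ∧
        ¬ (p : ℤ) ∣ ((V.baseChange (𝔭.adicCompletion F)).localPolynomial
          (𝔭.adicCompletionIntegers F)).coeff 1) →
      1 ≤ V.analyticRank → 1 ≤ V.selmerCorank p := by
  intro F _ _ _ V _ p _ hd h5 hdisc hirr hord hpos
  obtain ⟨E, C, h⟩ := V.exists_variableChange_smul_baseChange_eq (R := 𝓞 F)
  refine hW F V p h5 hdisc hirr hord ⟨E, C, h, hDNS F hd E (Δ_ne_zero_of_smul_baseChange_eq h)⟩ ?_ hpos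
  intro heven
  exfalso
  rw [hd] at heven
  exact Nat.not_even_iff_odd.2 (by decide) heven

/-- **Degree 2: stub A at even order for real QUADRATIC fields from two printed theorems** — Wan 2015 Thm. 7
(`Wan2015_theorem7_ellipticCurve`) and Freitas–Le Hung–Siksek 2015 Thm. 1 (`FLS2015_theorem1`: elliptic curves over real
quadratic fields are modular) — for EVEN `ord_{s=1} L(V/F,s)` (sign `+1`, where Wan's (iii) is vacuous; in
particular in the plectic regime `r_an = 2`). The odd-order half is the parity theorem (`hOdd` of `stub_firstZero_of_wan`).
[cite: Wan2015HilbertIMC, Thm. 7] [cite: FreitasLeHungSiksek2015, Thm. 1] -/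
theorem stub_firstZero_two_of_wan_of_FLS (hW : Wan2015_theorem7_ellipticCurve) (hFLS : FLS2015_theorem1) :
    ∀ (F : Type) [Field F] [NumberField F] [NumberField.IsTotallyReal F] (V : WeierstrassCurve F)
      [V.IsElliptic] (p : ℕ) [Fact p.Prime], Module.finrank ℚ F = 2 → 5 ≤ p → ¬ ((p : ℤ) ∣ NumberField.discr F) →
      V.HasIrreducibleModPGaloisRep p →
      (∀ 𝔭 : HeightOneSpectrum (𝓞 F), (p : 𝓞 F) ∈ 𝔭.asIdeal →
        ((V.baseChange (𝔭.adicCompletion F)).localPolynomial (𝔭.adicCompletionIntegers F)).natDegree = 2 ∧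
        ¬ (p : ℤ) ∣ ((V.baseChange (𝔭.adicCompletion F)).localPolynomial
          (𝔭.adicCompletionIntegers F)).coeff 1) →
      Even V.analyticRank → 1 ≤ V.analyticRank → 1 ≤ V.selmerCorank p := by
  intro F _ _ _ V _ p _ hd h5 hdisc hirr hord heven hpos
  obtain ⟨E, C, h⟩ := V.exists_variableChange_smul_baseChange_eq (R := 𝓞 F)
  refine hW F V p h5 hdisc hirr hord ⟨E, C, h, hFLS F hd E (Δ_ne_zero_of_smul_baseChange_eq h)⟩ ?_ hpos
  intro _ hodd
  exact absurd heven (Nat.not_even_iff_odd.2 hodd)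

/-- **Degree 4 without `√5`: stub A at even order from two printed theorems** — Wan 2015 Thm. 7 (`Wan2015_theorem7_ellipticCurve`)
and Box 2022 Thm. 1.1 (`Box2022_theorem1_1`: elliptic curves over totally real quartic fields not containing
`√5` are modular) — for EVEN `ord_{s=1} L(V/F,s)` (in particular in the plectic regime `r_an = 4`).
[cite: Wan2015HilbertIMC, Thm. 7] [cite: Box2022, Thm. 1.1] -/
theorem stub_firstZero_four_of_wan_of_Box (hW : Wan2015_theorem7_ellipticCurve) (hBox : Box2022_theorem1_1) :
    ∀ (F : Type) [Field F] [NumberField F] [NumberField.IsTotallyReal F] (V : WeierstrassCurve F)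
      [V.IsElliptic] (p : ℕ) [Fact p.Prime], Module.finrank ℚ F = 4 → ¬ IsSquare (5 : F) → 5 ≤ p →
      ¬ ((p : ℤ) ∣ NumberField.discr F) → V.HasIrreducibleModPGaloisRep p →
      (∀ 𝔭 : HeightOneSpectrum (𝓞 F), (p : 𝓞 F) ∈ 𝔭.asIdeal →
        ((V.baseChange (𝔭.adicCompletion F)).localPolynomial (𝔭.adicCompletionIntegers F)).natDegree = 2 ∧
        ¬ (p : ℤ) ∣ ((V.baseChange (𝔭.adicCompletion F)).localPolynomial
          (𝔭.adicCompletionIntegers F)).coeff 1) →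
      Even V.analyticRank → 1 ≤ V.analyticRank → 1 ≤ V.selmerCorank p := by
  intro F _ _ _ V _ p _ hd h5F h5 hdisc hirr hord heven hpos
  obtain ⟨E, C, h⟩ := V.exists_variableChange_smul_baseChange_eq (R := 𝓞 F)
  refine hW F V p h5 hdisc hirr hord ⟨E, C, h, hBox F hd h5F E (Δ_ne_zero_of_smul_baseChange_eq h)⟩ ?_ hpos
  intro _ hodd
  exact absurd heven (Nat.not_even_iff_odd.2 hodd)

/-- **Odd degree in general: stub A from Wan + modularity alone** (Wan's (iii) is vacuous for `[F:ℚ]` odd).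
[cite: Wan2015HilbertIMC, Thm. 7] -/
theorem stub_firstZero_oddDegree_of_wan (hW : Wan2015_theorem7_ellipticCurve) (hMod : TotallyRealWeightZeroAutomorphic) :
    ∀ (F : Type) [Field F] [NumberField F] [NumberField.IsTotallyReal F] (V : WeierstrassCurve F)
      [V.IsElliptic] (p : ℕ) [Fact p.Prime], Odd (Module.finrank ℚ F) → 5 ≤ p → ¬ ((p : ℤ) ∣ NumberField.discr F) →
      V.HasIrreducibleModPGaloisRep p →
      (∀ 𝔭 : HeightOneSpectrum (𝓞 F), (p : 𝓞 F) ∈ 𝔭.asIdeal →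
        ((V.baseChange (𝔭.adicCompletion F)).localPolynomial (𝔭.adicCompletionIntegers F)).natDegree = 2 ∧
        ¬ (p : ℤ) ∣ ((V.baseChange (𝔭.adicCompletion F)).localPolynomial
          (𝔭.adicCompletionIntegers F)).coeff 1) →
      1 ≤ V.analyticRank → 1 ≤ V.selmerCorank p := by
  intro F _ _ _ V _ p _ hd h5 hdisc hirr hord hpos
  refine hW F V p h5 hdisc hirr hord (exists_integralModel_isAutomorphicOfWeightZero hMod F V) ?_ hpos
  intro heven
  exact absurd heven (Nat.not_even_iff_odd.2 hd)

end Summit.BirchSwinnertonDyer.BirchSwinnertonDyer.Theorems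

end
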